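/-
Copyright (c) 2026 the pub-hodgecm-mathlib formalisation cell (harness21).  Prover seat hodgecm-mathlib-LH7-p09 (g2), CLOSE-OUT ROSTER strike line L3∕L5 (Track A
«(D-RAM) FOUR-FRAME» squad F0∕P3c∕LH4 ∕ F0∕P3c∕LH7); β₂-BOARD row (L-P) «populated ∕ unlabelled cells pay 0» (lineage LH7-p09 (g0)), the TERMINAL CELL half asked by
LH4-p15 (g0) 21:34:03Z CHECK ITEM (a) and by the β₂ sub-dealer LH4-p04 (g9) (L-Σ-3B) NEXT CUT «ROW b = m∕2»; helper lane on h413 = stmt-HodgeConjecture-24833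
(count-neutral).  2026-09-04.
-/
import Summits.HodgeConjecture.HodgeConjecture.Theorems.F0P3cDyRamTerminalCellUnlabelledCardTwo   -- ★ p862103 (LH4-p15 (g0)): the terminal letters; brings ★ p862037 `v_map_eq_one_iff` ∕ `v_map_lt_one_iff_of_le_iff`, ★ p861810 `v_map_le_map_pow_of_le`, ★ p861224 `v_add_lt_one_of_v_eq_one_of_card_two`
import Summits.HodgeConjecture.HodgeConjecture.Theorems.F0P3cDyRamShellLineModel                  -- ★ (LH4 β₂ road): `latticeInLevel_endoGL_sub_one_iff_isOrd` (the three level clauses of a glued vertex in the line model)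
import HarnessLib

/-!
# Crux `H413`, line LH4 «(D-RAM) FOUR-FRAME» — the (β₂) road (R-36) «PURE-CELL LEDGER», row (L-P): «THE TERMINAL CELL IS OFF THE CLEAN SHELL (q = 2)» — on the terminal
# cone cell (`|μ − ρμ| = |cc(α − ρα)|·|Y|`, `|μ| = |Y|² = |ϖE|^{2b}`, conductor `|cc| < |ϖE|^b`) EVERY glued vertex has `(Γ − 1)·L ⊆ ϖ·L`, so it is on NO `(0, m_c)` shell

Cell `hodgecm-mathlib` (D-0151), FLOOR 0, crux item H413 = `stmt-HodgeConjecture-24833`, route of record `HCCMUnconditional`; squads F0∕P3c∕LH4 ∕ LH7; lane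
`--supports stmt-HodgeConjecture-24833 --as helper` (count-neutral; pays NO tier-0 row).  THEOREMS ONLY (no `def`, no instance, no notation, no `sorry`, default heartbeats);
★-only imports; states NO law; (β₂) stays a HYPOTHESIS.  DATUM-FREE: plane field `E` with `#𝓀[E] = 2` and `|ϖ| = exp(−1)`, line model `(M, jE, ρ, α)` (★ (C1) letters:
`ρ` an isometric involution fixing exactly `jE(E)`, `hEval`), a glued vertex `L` with tube `b` over `Λ = φ(B₂) = x₀·𝒪_cc`, `φ w₀ = Y⁻¹x₀` (★ `…ShellLineModel` letters VERBATIM).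

WHY.  ★ p862103 (LH4-p15 (g0)) shows that on the TERMINAL cell (`δ = c`: the anti-invariant part of the depth multiplier `μ = lam − jE u₀₀` has EXACTLY the size
`|cc(α − ρα)|·|Y|` of the cell's conductor bound) the value set of `Γ − 1` on the glued vertex is NEITHER label class.  In the (β₂) cell currency of ★ p861305 the label
`Q₋ := shell(ℓ₀, m_c) ∧ ¬(VS = V₊)` would count such a vertex as MINUS if it sat on the clean shell (LH4-p15 21:34:03Z CHECK ITEM; LH4-cdis1 TYPED-CURRENCY AUDIT v1: the engines see
NO terminal term in regime, and every unlabelled vertex at `d = 2` is OFF the `ℓ₀ = 0` shell BY THE LEVEL DIGIT, `lev = 2`).  THIS FILE proves the level digit: with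
`μ = A + B·α`, `Y = P + Q·α` over `Fix ρ = jE(E)` (`B = (μ − ρμ)∕(α − ρα)`, `Q = (Y − ρY)∕(α − ρα)`) one has `μ∕Y − ρ(μ∕Y) = (BP − AQ)(α − ρα)∕(Y·ρY)` (§1), and on the terminal
cell `|BP| = |AQ| = |cc|·|ϖE|^{2b}` EXACTLY (`|Q| = |cc|` is Gram-primitivity + `hEval`; `|P| = |Y|`, `|A| = |μ|` need `|cc| < |ϖE|^b`, i.e. the cell lies above the diagonal) — two
ρ-FIXED elements of equal size, whose difference at `#𝓀[E] = 2` drops a digit (★ p861224 `v_add_lt_one_of_v_eq_one_of_card_two`).  Hence (§2) `|μ∕Y − ρ(μ∕Y)| ≤ |cc(α − ρα)|·|ϖE|`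
— the cell's own depth clause `IsOrd cc (μ∕Y)` ONE DIGIT UP, `IsOrd cc (μ∕(ϖE·Y))` — which is the third clause of ★ `…ShellLineModel.latticeInLevel_endoGL_sub_one_iff_isOrd` AT
LEVEL 1; the other two clauses at level 1 are `|u₀₀ − 1| ≤ |ϖ|` (`hum`, `1 ≤ m`) and `|μ − ρμ| ≤ |cc(α − ρα)|·|ϖE|` (`1 ≤ b`).  So (§3 HEAD) `LatticeInLevel ϖ 1 (Γ − 1) L`, whence
`¬ LatticeNearTransvShell ϖ 0 m (Γ − 1) L` for EVERY `m`: at `d` even (`ℓ₀ = 0`) the terminal cell pays `0` to ANY labelled difference in ★ p861305's currency (both `Q₊` and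
`Q₋` are false on it; ★ p861332 `natCast_finsum_sub_eq_zero_of_forall_not`).  MODEL (LH4-p15's `tower_experiment.v1` extended with the six clauses, this seat's
`shell_experiment.v1`, E = ℚ₂(i), d = 2, m = 4, δ ∈ {4, 6, 8}): terminal cells 96∕96 vertices `lev = 2`, every other cell 168∕168 vertices `lev = 0` exactly.
WHAT IS NOT CLAIMED.  `d` odd (`ℓ₀ = 1`: the same digit only reaches level `1 = ℓ₀`; there the square digit decides — other hand); which cells are terminal (the consumer reads
`2b = m`, `cc = ϖE^j`, `j = jl − b − v(α − ρα)` off its key letters `hm hjl`); any census law.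
HONEST LABEL.  Count-neutral valuation algebra; nothing printed is asserted; no census law is stated; `HC_CM` is proved only modulo the 7 printed citations (2 remaining named inputs:
hLiu418 = `stmt-HodgeConjecture-24832`, h413 = `stmt-HodgeConjecture-24833`) until rung 0 closes.
## References
* [Serre1979] J.-P. Serre, *Local Fields*, GTM 67 (1979): Ch. I §1 (discrete valuations, residue field); Ch. III §6 Prop. 12 (orders of conductor `c`).
* [Kottwitz1986BaseChangeUnits] R. E. Kottwitz, *Base change for unit elements of Hecke algebras*, Compositio Math. 60 (1986): §1 pp. 240–241, §3 (congruence levels on lattices).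
* [Jacobowitz1962] R. Jacobowitz, *Hermitian forms over local fields*, Amer. J. Math. 84 (1962): §4 (duals, gluing).
* [Rogawski1990] J. D. Rogawski, *Automorphic Representations of Unitary Groups in Three Variables*, Ann. of Math. Stud. 123 (1990): §4.9 Prop. 4.9.1 (b) p. 55.
-/

set_option autoImplicit false

noncomputable section

namespace Summit.HodgeConjecture.HodgeConjecture.Cruxes.H413.F0P3cDyRamTerminalCellOffShellCardTwo

open scoped Valued WithZero Matrix MatrixGroups
open WithZero
open Literature.NumberTheory.Automorphic Literature.NumberTheory.Automorphic.HermitianLattice Literature.NumberTheory.Automorphic.UnitaryLatticeTree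
open Literature.NumberTheory.Rogawski1990
open Summit.HodgeConjecture.HodgeConjecture.Cruxes.H413.F0P3cDyRamToricCensusDefs
open Summit.HodgeConjecture.HodgeConjecture.Cruxes.H413.F0P3cDyRamFourFrameCensusDefs (LatticeInLevel LatticeNearTransvShell)
open Summit.HodgeConjecture.HodgeConjecture.Cruxes.H413.F0P3cDyRamShellLineModel (latticeInLevel_endoGL_sub_one_iff_isOrd)
open Summit.HodgeConjecture.HodgeConjecture.Cruxes.H413.F0P3cDyRamCoreHangingEmptyOfCardTwo (v_add_lt_one_of_v_eq_one_of_card_two)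
open Summit.HodgeConjecture.HodgeConjecture.Cruxes.H413.F0P3cDyRamBoundaryCellLetterCardTwo (v_map_eq_one_iff v_map_lt_one_iff_of_le_iff)
open Summit.HodgeConjecture.HodgeConjecture.Cruxes.H413.F0P3cDyRamRayDominatedCellLetter (v_map_le_map_pow_of_le)

variable {E M : Type} [Field E] [Valued E ℤᵐ⁰] [Field M] [Valued M ℤᵐ⁰] {ρ : M →+* M} {α : M}

/-! ## §1 Coordinates over the fixed field: `z = A + B·α`, `B = (z − ρz)∕(α − ρα)` -/

omit [Valued M ℤᵐ⁰] in
/-- The `α`-coordinate `B = (z − ρz)∕(α − ρα)` of `z` is `ρ`-fixed (`ρ` an involution, `ρα ≠ α`). [cite: Serre1979, Ch. III §6 Prop. 12] -/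
theorem map_sub_div_eq (hρρ : ∀ x, ρ (ρ x) = x) (z : M) :
    ρ ((z - ρ z) / (α - ρ α)) = (z - ρ z) / (α - ρ α) := by
  rw [map_div₀, map_sub, map_sub, hρρ, hρρ, ← neg_sub z, ← neg_sub α, neg_div_neg_eq]

omit [Valued M ℤᵐ⁰] in
/-- The constant coordinate `A = z − B·α` of `z` is `ρ`-fixed. [cite: Serre1979, Ch. III §6 Prop. 12] -/
theorem map_sub_mul_eq (hρρ : ∀ x, ρ (ρ x) = x) (hα : ρ α ≠ α) (z : M) :
    ρ (z - (z - ρ z) / (α - ρ α) * α) = z - (z - ρ z) / (α - ρ α) * α := by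
  have hα0 : α - ρ α ≠ 0 := sub_ne_zero.2 (Ne.symm hα)
  rw [map_sub, map_mul, map_sub_div_eq hρρ z]
  field_simp
  ring

omit [Valued M ℤᵐ⁰] in
/-- **THE ANTI-INVARIANT PART OF A QUOTIENT IN COORDINATES**: with `μ = A + B·α`, `Y = P + Q·α` (`B = (μ − ρμ)∕(α − ρα)`, `Q = (Y − ρY)∕(α − ρα)`),
`μ·ρY − Y·ρμ = (B·P − A·Q)·(α − ρα)` — the numerator of `μ∕Y − ρ(μ∕Y)`. [cite: Serre1979, Ch. III §6 Prop. 12] -/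
theorem mul_map_sub_mul_map_eq (hα : ρ α ≠ α) {μ Y A B P Q : M}
    (hB : B = (μ - ρ μ) / (α - ρ α)) (hA : A = μ - B * α) (hQ : Q = (Y - ρ Y) / (α - ρ α)) (hP : P = Y - Q * α) :
    μ * ρ Y - Y * ρ μ = (B * P - A * Q) * (α - ρ α) := by
  have hα0 : α - ρ α ≠ 0 := sub_ne_zero.2 (Ne.symm hα)
  subst hA hP
  subst hB hQ
  field_simp
  ring

/-! ## §2 The terminal cell: the depth quotient lies ONE DIGIT inside the order -/

/-- **THE TERMINAL DIGIT (q = 2).**  Line model `(M, jE, ρ, α)`: `ρ` an isometric involution with `Fix ρ = jE(E)`, `|jE c| ≤ 1 ↔ |c| ≤ 1`, fixed integers have `|·| ∈ |ϖE|^ℕ`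
(`hEval`), `|α| ≤ 1`, `ρα ≠ α`; `|ϖ| = exp(−1)`, `#𝓀[E] = 2`.  CELL letters: `cc` fixed non-zero, `Y ∈ 𝒪_cc` (`IsOrd`), Gram-primitive (`¬ IsOrd (Y∕ϖE)`), `|Y| = |ϖE|^b`,
`1 ≤ b`, and the cell lies above the diagonal `|cc| < |ϖE|^b`.  TERMINAL letters: `|μ| = |ϖE|^{2b}` and `|μ − ρμ| = |cc·(α − ρα)·Y|`.  THEN `|μ∕Y − ρ(μ∕Y)| ≤ |cc(α − ρα)|·|ϖE|`.
[cite: Serre1979, Ch. I §1; Ch. III §6 Prop. 12] [cite: Kottwitz1986BaseChangeUnits, §1 pp. 240–241] -/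
theorem v_div_sub_map_div_le_of_terminal [Fintype 𝓀[E]] (hq : Fintype.card 𝓀[E] = 2)
    (hρρ : ∀ x, ρ (ρ x) = x) (hvρ : ∀ x, Valued.v (ρ x) = Valued.v x) (hα : ρ α ≠ α) (hα1 : Valued.v α ≤ 1)
    (jE : E →+* M) (hjv : ∀ c, Valued.v (jE c) ≤ 1 ↔ Valued.v c ≤ 1) (hjfix : ∀ z, ρ z = z ↔ ∃ c, jE c = z)
    {ϖ : E} (hϖ : Valued.v ϖ = exp (-1 : ℤ))
    (hEval : ∀ c : M, ρ c = c → c ≠ 0 → Valued.v c ≤ 1 → ∃ n : ℕ, Valued.v c = Valued.v (jE ϖ) ^ n)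
    {cc : M} (hc : ρ cc = cc) (hc0 : cc ≠ 0) {Y : M} (hYO : IsOrd ρ α cc Y) (hYp : ¬ IsOrd ρ α cc (Y / jE ϖ))
    {b : ℕ} (hb1 : 1 ≤ b) (hYb : Valued.v Y = Valued.v (jE ϖ) ^ b) (hcb : Valued.v cc < Valued.v (jE ϖ) ^ b)
    {μ : M} (hμ : Valued.v μ = Valued.v (jE ϖ) ^ (2 * b)) (hjl0 : Valued.v (μ - ρ μ) = Valued.v (cc * (α - ρ α) * Y)) :
    Valued.v (μ / Y - ρ (μ / Y)) ≤ Valued.v (cc * (α - ρ α)) * Valued.v (jE ϖ) := by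
  have hα0 : α - ρ α ≠ 0 := sub_ne_zero.2 (Ne.symm hα)
  have hvα0 : Valued.v (α - ρ α) ≠ 0 := (Valuation.ne_zero_iff _).2 hα0
  have hvϖ0 : Valued.v ϖ ≠ 0 := by rw [hϖ]; exact exp_ne_zero
  have hϖ0 : ϖ ≠ 0 := fun h0 => hvϖ0 (by rw [h0, map_zero])
  have hϖlt : Valued.v ϖ < 1 := by rw [hϖ, ← exp_zero, exp_lt_exp]; norm_num
  have hjϖ0 : jE ϖ ≠ 0 := (map_ne_zero jE).2 hϖ0
  have hvjϖ0 : Valued.v (jE ϖ) ≠ 0 := (Valuation.ne_zero_iff _).2 hjϖ0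
  have hvjϖpos : 0 < Valued.v (jE ϖ) := zero_lt_iff.2 hvjϖ0
  have hjϖlt : Valued.v (jE ϖ) < 1 := (v_map_lt_one_iff_of_le_iff jE hjv ϖ).2 hϖlt
  have hρϖ : ρ (jE ϖ) = jE ϖ := (hjfix _).2 ⟨ϖ, rfl⟩
  have hvc0 : Valued.v cc ≠ 0 := (Valuation.ne_zero_iff _).2 hc0
  have hY0 : Y ≠ 0 := fun h0 => by
    rw [h0, Valuation.map_zero] at hYb
    exact pow_ne_zero b hvjϖ0 hYb.symm
  have hvY0 : Valued.v Y ≠ 0 := (Valuation.ne_zero_iff _).2 hY0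
  have hρY0 : ρ Y ≠ 0 := (map_ne_zero ρ).2 hY0
  -- coordinates over the fixed field
  set B : M := (μ - ρ μ) / (α - ρ α) with hBdef
  set Q : M := (Y - ρ Y) / (α - ρ α) with hQdef
  set A : M := μ - B * α with hAdef
  set P : M := Y - Q * α with hPdef
  have hρB : ρ B = B := map_sub_div_eq hρρ μ
  have hρQ : ρ Q = Q := map_sub_div_eq hρρ Y
  have hρA : ρ A = A := by rw [hAdef, hBdef]; exact map_sub_mul_eq hρρ hα μ
  have hρP : ρ P = P := by rw [hPdef, hQdef]; exact map_sub_mul_eq hρρ hα Y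
  clear_value A P
  clear_value B Q
  -- `|B| = |cc|·|Y|` (the terminal letter)
  have hvB : Valued.v B = Valued.v cc * Valued.v Y := by
    rw [hBdef, Valuation.map_div, hjl0, Valuation.map_mul, Valuation.map_mul, mul_right_comm, mul_div_assoc, div_self hvα0, mul_one]
  -- `|Q| = |cc|` (order membership + Gram-primitivity + `hEval`)
  have hvQle : Valued.v Q ≤ Valued.v cc := by
    rw [hQdef, Valuation.map_div, div_le_iff₀ (zero_lt_iff.2 hvα0), ← Valuation.map_mul]
    exact hYO.2
  have hvQgt : Valued.v cc * Valued.v (jE ϖ) < Valued.v Q := by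
    have h1 : Valued.v (Y / jE ϖ) ≤ 1 := by
      rw [Valuation.map_div, hYb, div_le_one₀ hvjϖpos]
      calc Valued.v (jE ϖ) ^ b ≤ Valued.v (jE ϖ) ^ 1 := pow_le_pow_right_of_le_one' hjϖlt.le hb1
        _ = Valued.v (jE ϖ) := pow_one _
    have h2 : ¬ Valued.v (Y / jE ϖ - ρ (Y / jE ϖ)) ≤ Valued.v (cc * (α - ρ α)) := fun h => hYp ⟨h1, h⟩
    rw [not_le, map_div₀, hρϖ, ← sub_div, Valuation.map_div, lt_div_iff₀ hvjϖpos] at h2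
    rw [hQdef, Valuation.map_div, lt_div_iff₀ (zero_lt_iff.2 hvα0)]
    calc Valued.v cc * Valued.v (jE ϖ) * Valued.v (α - ρ α) = Valued.v (cc * (α - ρ α)) * Valued.v (jE ϖ) := by
          rw [Valuation.map_mul]; ac_rfl
      _ < Valued.v (Y - ρ Y) := h2
  have hQ0 : Q ≠ 0 := fun h0 => by
    rw [h0, Valuation.map_zero] at hvQgt
    exact absurd hvQgt (not_lt.2 zero_le)
  have hvQ : Valued.v Q = Valued.v cc := by
    have hρQc : ρ (Q / cc) = Q / cc := by rw [map_div₀, hρQ, hc]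
    have hle : Valued.v (Q / cc) ≤ 1 := by rw [Valuation.map_div, div_le_one₀ (zero_lt_iff.2 hvc0)]; exact hvQle
    obtain ⟨n, hn⟩ := hEval _ hρQc (div_ne_zero hQ0 hc0) hle
    have hgt : Valued.v (jE ϖ) < Valued.v (Q / cc) := by
      rw [Valuation.map_div, lt_div_iff₀ (zero_lt_iff.2 hvc0), mul_comm]; exact hvQgt
    rw [hn] at hgt
    have hn0 : n = 0 := by
      by_contra hne
      have h := pow_le_pow_right_of_le_one' hjϖlt.le (Nat.one_le_iff_ne_zero.2 hne)
      rw [pow_one] at h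
      exact absurd (lt_of_lt_of_le hgt h) (lt_irrefl _)
    rw [hn0, pow_zero, Valuation.map_div, div_eq_one_iff_eq hvc0] at hn
    exact hn
  -- `|P| = |Y|`, `|A| = |μ|` (the cell lies above the diagonal)
  have hvP : Valued.v P = Valued.v Y := by
    have hlt : Valued.v (Q * α) < Valued.v Y := by
      rw [Valuation.map_mul, hvQ, hYb]
      calc Valued.v cc * Valued.v α ≤ Valued.v cc * 1 := mul_le_mul_right hα1 _
        _ = Valued.v cc := mul_one _
        _ < Valued.v (jE ϖ) ^ b := hcb
    rw [hPdef, sub_eq_add_neg, Valuation.map_add_eq_of_lt_left _ (by rw [Valuation.map_neg]; exact hlt)]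
  have hvA : Valued.v A = Valued.v μ := by
    have hlt : Valued.v (B * α) < Valued.v μ := by
      rw [Valuation.map_mul, hvB, hμ, hYb]
      calc Valued.v cc * Valued.v (jE ϖ) ^ b * Valued.v α ≤ Valued.v cc * Valued.v (jE ϖ) ^ b * 1 := mul_le_mul_right hα1 _
        _ = Valued.v cc * Valued.v (jE ϖ) ^ b := mul_one _
        _ < Valued.v (jE ϖ) ^ b * Valued.v (jE ϖ) ^ b := mul_lt_mul_of_pos_right hcb (pow_pos hvjϖpos _)
        _ = Valued.v (jE ϖ) ^ (2 * b) := by rw [← pow_add, two_mul]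
    rw [hAdef, sub_eq_add_neg, Valuation.map_add_eq_of_lt_left _ (by rw [Valuation.map_neg]; exact hlt)]
  -- `|B P| = |A Q| = |cc|·|ϖE|^{2b}`
  have hvBP : Valued.v (B * P) = Valued.v cc * Valued.v (jE ϖ) ^ (2 * b) := by
    rw [Valuation.map_mul, hvB, hvP, hYb, mul_assoc, ← pow_add, two_mul]
  have hvAQ : Valued.v (A * Q) = Valued.v cc * Valued.v (jE ϖ) ^ (2 * b) := by
    rw [Valuation.map_mul, hvA, hvQ, hμ, mul_comm]
  have hvBP0 : Valued.v (B * P) ≠ 0 := by rw [hvBP]; exact mul_ne_zero hvc0 (pow_ne_zero _ hvjϖ0)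
  have hBP0 : B * P ≠ 0 := (Valuation.ne_zero_iff _).1 hvBP0
  -- the ratio `A Q ∕ (B P)` is a `ρ`-fixed unit, i.e. `jE` of a unit of `E`; at `#𝓀[E] = 2` its distance to `1` is `≤ |ϖ|`
  have hρr : ρ (A * Q / (B * P)) = A * Q / (B * P) := by rw [map_div₀, map_mul, map_mul, hρA, hρQ, hρB, hρP]
  obtain ⟨e, he⟩ := (hjfix _).1 hρr
  have hvr : Valued.v (A * Q / (B * P)) = 1 := by rw [Valuation.map_div, hvAQ, ← hvBP, div_self hvBP0]
  have hve : Valued.v e = 1 := (v_map_eq_one_iff jE hjv e).1 (by rw [he]; exact hvr)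
  have h1e : Valued.v (1 - e) < 1 := by
    have h := v_add_lt_one_of_v_eq_one_of_card_two hq (show Valued.v (1 : E) = 1 from Valuation.map_one _)
      (show Valued.v (-e) = 1 by rw [Valuation.map_neg, hve])
    rwa [← sub_eq_add_neg] at h
  have h1e' : Valued.v (1 - e) ≤ Valued.v ϖ ^ 1 := by
    have h := WithZero.lt_mul_exp_iff_le (x := Valued.v (1 - e)) (y := exp (-1 : ℤ)) exp_ne_zero
    rw [← exp_add, show (-1 : ℤ) + 1 = 0 by norm_num, exp_zero] at h
    rw [pow_one, hϖ]; exact h.1 h1e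
  have hj1e : Valued.v (jE (1 - e)) ≤ Valued.v (jE ϖ) := by
    have h := v_map_le_map_pow_of_le jE hjv hϖ0 h1e'
    rwa [pow_one] at h
  -- `|B P − A Q| ≤ |B P|·|ϖE|`
  have hdiff : Valued.v (B * P - A * Q) ≤ Valued.v cc * Valued.v (jE ϖ) ^ (2 * b) * Valued.v (jE ϖ) := by
    have e1 : B * P - A * Q = B * P * jE (1 - e) := by
      rw [map_sub, map_one, he, mul_sub, mul_one, mul_div_cancel₀ _ hBP0]
    rw [e1, Valuation.map_mul, hvBP]
    exact mul_le_mul_right hj1e _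
  -- conclude through the coordinate identity
  have hanti : μ / Y - ρ (μ / Y) = (B * P - A * Q) * (α - ρ α) / (Y * ρ Y) := by
    rw [map_div₀, div_sub_div _ _ hY0 hρY0, mul_map_sub_mul_map_eq hα hBdef hAdef hQdef hPdef]
  rw [hanti, Valuation.map_div, Valuation.map_mul, Valuation.map_mul, hvρ, hYb,
    div_le_iff₀ (mul_pos (pow_pos hvjϖpos _) (pow_pos hvjϖpos _))]
  calc Valued.v (B * P - A * Q) * Valued.v (α - ρ α)
      ≤ Valued.v cc * Valued.v (jE ϖ) ^ (2 * b) * Valued.v (jE ϖ) * Valued.v (α - ρ α) := mul_le_mul_left hdiff _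
    _ = Valued.v (cc * (α - ρ α)) * Valued.v (jE ϖ) * (Valued.v (jE ϖ) ^ b * Valued.v (jE ϖ) ^ b) := by
          rw [Valuation.map_mul, two_mul, pow_add]; ac_rfl

/-- **THE TERMINAL CELL'S DEPTH QUOTIENT LIES ONE DIGIT INSIDE THE ORDER**: under the letters of `v_div_sub_map_div_le_of_terminal`, `IsOrd ρ α cc (μ ∕ (ϖE·Y))` — the third
clause of ★ `…ShellLineModel.latticeInLevel_endoGL_sub_one_iff_isOrd` at level `1` (the cell's own depth clause `IsOrd cc (μ∕Y)` is the same estimate one digit lower).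
[cite: Serre1979, Ch. III §6 Prop. 12] [cite: Kottwitz1986BaseChangeUnits, §3] -/
theorem isOrd_div_mul_of_terminal [Fintype 𝓀[E]] (hq : Fintype.card 𝓀[E] = 2)
    (hρρ : ∀ x, ρ (ρ x) = x) (hvρ : ∀ x, Valued.v (ρ x) = Valued.v x) (hα : ρ α ≠ α) (hα1 : Valued.v α ≤ 1)
    (jE : E →+* M) (hjv : ∀ c, Valued.v (jE c) ≤ 1 ↔ Valued.v c ≤ 1) (hjfix : ∀ z, ρ z = z ↔ ∃ c, jE c = z)
    {ϖ : E} (hϖ : Valued.v ϖ = exp (-1 : ℤ))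
    (hEval : ∀ c : M, ρ c = c → c ≠ 0 → Valued.v c ≤ 1 → ∃ n : ℕ, Valued.v c = Valued.v (jE ϖ) ^ n)
    {cc : M} (hc : ρ cc = cc) (hc0 : cc ≠ 0) {Y : M} (hYO : IsOrd ρ α cc Y) (hYp : ¬ IsOrd ρ α cc (Y / jE ϖ))
    {b : ℕ} (hb1 : 1 ≤ b) (hYb : Valued.v Y = Valued.v (jE ϖ) ^ b) (hcb : Valued.v cc < Valued.v (jE ϖ) ^ b)
    {μ : M} (hμ : Valued.v μ = Valued.v (jE ϖ) ^ (2 * b)) (hjl0 : Valued.v (μ - ρ μ) = Valued.v (cc * (α - ρ α) * Y)) :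
    IsOrd ρ α cc (μ / (jE ϖ * Y)) := by
  have key := v_div_sub_map_div_le_of_terminal hq hρρ hvρ hα hα1 jE hjv hjfix hϖ hEval hc hc0 hYO hYp hb1 hYb hcb hμ hjl0
  have hvϖ0 : Valued.v ϖ ≠ 0 := by rw [hϖ]; exact exp_ne_zero
  have hϖ0 : ϖ ≠ 0 := fun h0 => hvϖ0 (by rw [h0, map_zero])
  have hϖlt : Valued.v ϖ < 1 := by rw [hϖ, ← exp_zero, exp_lt_exp]; norm_num
  have hjϖ0 : jE ϖ ≠ 0 := (map_ne_zero jE).2 hϖ0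
  have hvjϖ0 : Valued.v (jE ϖ) ≠ 0 := (Valuation.ne_zero_iff _).2 hjϖ0
  have hvjϖpos : 0 < Valued.v (jE ϖ) := zero_lt_iff.2 hvjϖ0
  have hjϖlt : Valued.v (jE ϖ) < 1 := (v_map_lt_one_iff_of_le_iff jE hjv ϖ).2 hϖlt
  have hρϖ : ρ (jE ϖ) = jE ϖ := (hjfix _).2 ⟨ϖ, rfl⟩
  have hY0 : Y ≠ 0 := fun h0 => by
    rw [h0, Valuation.map_zero] at hYb
    exact pow_ne_zero b hvjϖ0 hYb.symm
  have hρY0 : ρ Y ≠ 0 := (map_ne_zero ρ).2 hY0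
  refine ⟨?_, ?_⟩
  · rw [Valuation.map_div, Valuation.map_mul, hμ, hYb, div_le_one₀ (mul_pos hvjϖpos (pow_pos hvjϖpos _))]
    calc Valued.v (jE ϖ) ^ (2 * b) ≤ Valued.v (jE ϖ) ^ (b + 1) := pow_le_pow_right_of_le_one' hjϖlt.le (by omega)
      _ = Valued.v (jE ϖ) * Valued.v (jE ϖ) ^ b := by rw [pow_succ']
  · have e : μ / (jE ϖ * Y) - ρ (μ / (jE ϖ * Y)) = (μ / Y - ρ (μ / Y)) / jE ϖ := by
      rw [map_div₀, map_div₀, map_mul, hρϖ]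
      field_simp
    rw [e, Valuation.map_div, div_le_iff₀ hvjϖpos]
    exact key

/-! ## §3 HEAD — the glued vertex over the terminal cell is on level `1`, hence on no `ℓ₀ = 0` shell -/

/-- **HEAD — «THE TERMINAL CELL IS OFF THE CLEAN SHELL» (q = 2), LEVEL FORM.**  Frame: ★ `…ShellLineModel.latticeInLevel_endoGL_sub_one_iff_isOrd`'s glued-vertex letters
VERBATIM (plane `E`, `|ϖ| = exp(−1)`, line model `(M, jE, ρ, α; φ, lam)`, vertex `L` with tube `b` over `(B₂, w₀, g₀)`, `Λ = φ(B₂) = x₀·𝒪_cc`, `φ w₀ = Y⁻¹x₀`) + the line-model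
letters `hρρ hα hα1 hjv hjfix hEval` + `#𝓀[E] = 2`; CELL letters `hc hc0 hYO hYp hb1 hYb hcb` (the cone cell `(j, b)` above the diagonal, `cc = ϖE^j`, `|Y| = |ϖE|^b`); the
literal's `hum : |u₀₀ − 1| ≤ |ϖ^m|` with `1 ≤ m`; TERMINAL letters `hμ : |lam − jE u₀₀| = |ϖE|^{2b}` (the row `2b = m`) and `hjl0 : |μ − ρμ| = |cc(α − ρα)·Y|` (`δ = c`).
THEN `LatticeInLevel ϖ 1 (Γ − 1) L`, `Γ = endoGL (γ₂, u)`: the vertex lies on level `≥ 1 > ℓ₀ = 0`. [cite: Kottwitz1986BaseChangeUnits, §3] [cite: Serre1979, Ch. III §6 Prop. 12]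
[cite: Jacobowitz1962, §4] -/
theorem latticeInLevel_one_endoGL_sub_one_of_terminal [Fintype 𝓀[E]] (hq : Fintype.card 𝓀[E] = 2)
    (hρρ : ∀ x, ρ (ρ x) = x) (hvρ : ∀ x, Valued.v (ρ x) = Valued.v x) (hα : ρ α ≠ α) (hα1 : Valued.v α ≤ 1)
    {ϖ : E} (hϖ : Valued.v ϖ = exp (-1 : ℤ))
    (jE : E →+* M) (hjv : ∀ c, Valued.v (jE c) ≤ 1 ↔ Valued.v c ≤ 1) (hjfix : ∀ z, ρ z = z ↔ ∃ c, jE c = z)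
    (hEval : ∀ c : M, ρ c = c → c ≠ 0 → Valued.v c ≤ 1 → ∃ n : ℕ, Valued.v c = Valued.v (jE ϖ) ^ n)
    (φ : (Fin 2 → E) →+ M) (hφs : ∀ (c : E) (x : Fin 2 → E), φ (c • x) = jE c * φ x) (hφi : Function.Injective φ)
    {γ₂ : GL (Fin 2) E} {lam : M} (hφγ : ∀ x, φ ((γ₂ : Matrix (Fin 2) (Fin 2) E) *ᵥ x) = lam * φ x)
    {L : Submodule 𝒪[E] (Fin 3 → E)} {b : ℕ} (hb : ∀ a : E, (Pi.single 1 a : Fin 3 → E) ∈ L ↔ Valued.v a ≤ Valued.v ϖ ^ b)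
    (hpr : ∀ x ∈ L, Valued.v (x 1) * Valued.v ϖ ^ b ≤ 1)
    {B₂ : Submodule 𝒪[E] (Fin 2 → E)} {w₀ : Fin 2 → E} {g₀ : Fin 3 → E}
    (hB : B₂.map ((Matrix.toLin' (!![1, 0; 0, 0; 0, 1] : Matrix (Fin 3) (Fin 2) E)).restrictScalars 𝒪[E]) =
      L ⊓ LinearMap.ker ((LinearMap.proj (1 : Fin 3) : (Fin 3 → E) →ₗ[E] E).restrictScalars 𝒪[E]))
    (hg₀ : g₀ ∈ L) (hg₀1 : Valued.v (g₀ 1) * Valued.v ϖ ^ b = 1) (hprg : g₀ - Pi.single 1 (g₀ 1) = ![w₀ 0, 0, w₀ 1])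
    {Λ : AddSubgroup M} (hBΛ : B₂.toAddSubgroup.map φ = Λ) {cc x₀ Y : M} (hc : ρ cc = cc) (hc0 : cc ≠ 0) (hx₀ : x₀ ≠ 0)
    (hΛx : ∀ x, x ∈ Λ ↔ ∃ z, IsOrd ρ α cc z ∧ x = x₀ * z) (hw₀Y : φ w₀ = Y⁻¹ * x₀)
    (hYO : IsOrd ρ α cc Y) (hYp : ¬ IsOrd ρ α cc (Y / jE ϖ)) (hb1 : 1 ≤ b) (hYb : Valued.v Y = Valued.v (jE ϖ) ^ b)
    (hcb : Valued.v cc < Valued.v (jE ϖ) ^ b)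
    (u : GL (Fin 1) E) {m : ℕ} (hm1 : 1 ≤ m) (hum : Valued.v ((u : Matrix (Fin 1) (Fin 1) E) 0 0 - 1) ≤ Valued.v (ϖ ^ m))
    (hμ : Valued.v (lam - jE ((u : Matrix (Fin 1) (Fin 1) E) 0 0)) = Valued.v (jE ϖ) ^ (2 * b))
    (hjl0 : Valued.v ((lam - jE ((u : Matrix (Fin 1) (Fin 1) E) 0 0)) - ρ (lam - jE ((u : Matrix (Fin 1) (Fin 1) E) 0 0))) =
      Valued.v (cc * (α - ρ α) * Y)) :
    LatticeInLevel ϖ 1 ((((endoGL (γ₂, u) : GL (Fin 3) E) : Matrix (Fin 3) (Fin 3) E) - 1)) L := by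
  have hvϖ0 : Valued.v ϖ ≠ 0 := by rw [hϖ]; exact exp_ne_zero
  have hϖ0 : ϖ ≠ 0 := fun h0 => hvϖ0 (by rw [h0, map_zero])
  have hϖlt : Valued.v ϖ < 1 := by rw [hϖ, ← exp_zero, exp_lt_exp]; norm_num
  have hjϖ0 : jE ϖ ≠ 0 := (map_ne_zero jE).2 hϖ0
  have hvjϖ0 : Valued.v (jE ϖ) ≠ 0 := (Valuation.ne_zero_iff _).2 hjϖ0
  have hvjϖpos : 0 < Valued.v (jE ϖ) := zero_lt_iff.2 hvjϖ0
  have hjϖlt : Valued.v (jE ϖ) < 1 := (v_map_lt_one_iff_of_le_iff jE hjv ϖ).2 hϖlt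
  have hvc0 : Valued.v cc ≠ 0 := (Valuation.ne_zero_iff _).2 hc0
  have hY0 : Y ≠ 0 := fun h0 => by
    rw [h0, Valuation.map_zero] at hYb
    exact pow_ne_zero b hvjϖ0 hYb.symm
  -- the literal's `u`-part is `ϖ^m`-close to `1`, hence `ϖ`-close
  have hum1 : Valued.v ((u : Matrix (Fin 1) (Fin 1) E) 0 0 - 1) ≤ Valued.v ϖ ^ 1 :=
    hum.trans (by rw [Valuation.map_pow]; exact pow_le_pow_right_of_le_one' hϖlt.le hm1)
  have hjum : Valued.v (jE ((u : Matrix (Fin 1) (Fin 1) E) 0 0) - 1) ≤ Valued.v (jE ϖ) := by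
    have h := v_map_le_map_pow_of_le jE hjv hϖ0 hum1
    rwa [pow_one, map_sub, map_one] at h
  -- `|μ| ≤ |ϖE|`, `|μ − ρμ| ≤ |cc(α − ρα)|·|ϖE|`
  have hμle : Valued.v (lam - jE ((u : Matrix (Fin 1) (Fin 1) E) 0 0)) ≤ Valued.v (jE ϖ) := by
    rw [hμ]
    calc Valued.v (jE ϖ) ^ (2 * b) ≤ Valued.v (jE ϖ) ^ 1 := pow_le_pow_right_of_le_one' hjϖlt.le (by omega)
      _ = Valued.v (jE ϖ) := pow_one _
  have hantile : Valued.v ((lam - jE ((u : Matrix (Fin 1) (Fin 1) E) 0 0)) - ρ (lam - jE ((u : Matrix (Fin 1) (Fin 1) E) 0 0))) ≤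
      Valued.v (cc * (α - ρ α)) * Valued.v (jE ϖ) := by
    rw [hjl0, Valuation.map_mul, hYb]
    refine mul_le_mul_right ?_ _
    calc Valued.v (jE ϖ) ^ b ≤ Valued.v (jE ϖ) ^ 1 := pow_le_pow_right_of_le_one' hjϖlt.le hb1
      _ = Valued.v (jE ϖ) := pow_one _
  rw [latticeInLevel_endoGL_sub_one_iff_isOrd hvρ hϖ jE φ hφs hφi hφγ hb hpr hB hg₀ hg₀1 hprg hBΛ hx₀ hY0 hΛx hw₀Y u 1, pow_one, pow_one]
  refine ⟨hum1.trans (le_of_eq (pow_one _)), ?_, ?_⟩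
  · -- `IsOrd cc ((lam − 1)∕ϖE)`
    have hρu : ρ (jE ((u : Matrix (Fin 1) (Fin 1) E) 0 0)) = jE ((u : Matrix (Fin 1) (Fin 1) E) 0 0) := (hjfix _).2 ⟨_, rfl⟩
    have hρϖ : ρ (jE ϖ) = jE ϖ := (hjfix _).2 ⟨ϖ, rfl⟩
    have hsplit : lam - 1 = (lam - jE ((u : Matrix (Fin 1) (Fin 1) E) 0 0)) + (jE ((u : Matrix (Fin 1) (Fin 1) E) 0 0) - 1) := by ring
    refine ⟨?_, ?_⟩
    · rw [Valuation.map_div, div_le_one₀ hvjϖpos, hsplit]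
      exact (Valuation.map_add _ _ _).trans (max_le hμle hjum)
    · have e : (lam - 1) / jE ϖ - ρ ((lam - 1) / jE ϖ) =
          ((lam - jE ((u : Matrix (Fin 1) (Fin 1) E) 0 0)) - ρ (lam - jE ((u : Matrix (Fin 1) (Fin 1) E) 0 0))) / jE ϖ := by
        rw [map_div₀, map_sub, map_one, hρϖ, map_sub, hρu]
        field_simp
        ring
      rw [e, Valuation.map_div, div_le_iff₀ hvjϖpos]
      exact hantile
  · exact isOrd_div_mul_of_terminal hq hρρ hvρ hα hα1 jE hjv hjfix hϖ hEval hc hc0 hYO hYp hb1 hYb hcb hμ hjl0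

/-- **HEAD — «THE TERMINAL CELL IS OFF THE CLEAN SHELL» (q = 2), SHELL FORM.**  Same letters: for EVERY square level `mc`, `¬ LatticeNearTransvShell ϖ 0 mc (Γ − 1) L` (the
shell asks `¬ LatticeInLevel ϖ 1 (Γ − 1) L`).  At `d` even (`ℓ₀ = d % 2 = 0`) both labels `Q₊ = shell(ℓ₀, m*) ∧ …` and `Q₋ = shell(ℓ₀, m_c) ∧ …` of ★ p861305's cell currency are
therefore FALSE on every glued vertex over the terminal cell, which pays `0` to the labelled difference (★ p861332 `natCast_finsum_sub_eq_zero_of_forall_not`).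
[cite: Kottwitz1986BaseChangeUnits, §3] [cite: Rogawski1990, §4.9 Prop. 4.9.1 (b) p. 55] [cite: Serre1979, Ch. III §6 Prop. 12] -/
theorem not_latticeNearTransvShell_zero_of_terminal [Fintype 𝓀[E]] (hq : Fintype.card 𝓀[E] = 2)
    (hρρ : ∀ x, ρ (ρ x) = x) (hvρ : ∀ x, Valued.v (ρ x) = Valued.v x) (hα : ρ α ≠ α) (hα1 : Valued.v α ≤ 1)
    {ϖ : E} (hϖ : Valued.v ϖ = exp (-1 : ℤ))
    (jE : E →+* M) (hjv : ∀ c, Valued.v (jE c) ≤ 1 ↔ Valued.v c ≤ 1) (hjfix : ∀ z, ρ z = z ↔ ∃ c, jE c = z)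
    (hEval : ∀ c : M, ρ c = c → c ≠ 0 → Valued.v c ≤ 1 → ∃ n : ℕ, Valued.v c = Valued.v (jE ϖ) ^ n)
    (φ : (Fin 2 → E) →+ M) (hφs : ∀ (c : E) (x : Fin 2 → E), φ (c • x) = jE c * φ x) (hφi : Function.Injective φ)
    {γ₂ : GL (Fin 2) E} {lam : M} (hφγ : ∀ x, φ ((γ₂ : Matrix (Fin 2) (Fin 2) E) *ᵥ x) = lam * φ x)
    {L : Submodule 𝒪[E] (Fin 3 → E)} {b : ℕ} (hb : ∀ a : E, (Pi.single 1 a : Fin 3 → E) ∈ L ↔ Valued.v a ≤ Valued.v ϖ ^ b)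
    (hpr : ∀ x ∈ L, Valued.v (x 1) * Valued.v ϖ ^ b ≤ 1)
    {B₂ : Submodule 𝒪[E] (Fin 2 → E)} {w₀ : Fin 2 → E} {g₀ : Fin 3 → E}
    (hB : B₂.map ((Matrix.toLin' (!![1, 0; 0, 0; 0, 1] : Matrix (Fin 3) (Fin 2) E)).restrictScalars 𝒪[E]) =
      L ⊓ LinearMap.ker ((LinearMap.proj (1 : Fin 3) : (Fin 3 → E) →ₗ[E] E).restrictScalars 𝒪[E]))
    (hg₀ : g₀ ∈ L) (hg₀1 : Valued.v (g₀ 1) * Valued.v ϖ ^ b = 1) (hprg : g₀ - Pi.single 1 (g₀ 1) = ![w₀ 0, 0, w₀ 1])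
    {Λ : AddSubgroup M} (hBΛ : B₂.toAddSubgroup.map φ = Λ) {cc x₀ Y : M} (hc : ρ cc = cc) (hc0 : cc ≠ 0) (hx₀ : x₀ ≠ 0)
    (hΛx : ∀ x, x ∈ Λ ↔ ∃ z, IsOrd ρ α cc z ∧ x = x₀ * z) (hw₀Y : φ w₀ = Y⁻¹ * x₀)
    (hYO : IsOrd ρ α cc Y) (hYp : ¬ IsOrd ρ α cc (Y / jE ϖ)) (hb1 : 1 ≤ b) (hYb : Valued.v Y = Valued.v (jE ϖ) ^ b)
    (hcb : Valued.v cc < Valued.v (jE ϖ) ^ b)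
    (u : GL (Fin 1) E) {m : ℕ} (hm1 : 1 ≤ m) (hum : Valued.v ((u : Matrix (Fin 1) (Fin 1) E) 0 0 - 1) ≤ Valued.v (ϖ ^ m))
    (hμ : Valued.v (lam - jE ((u : Matrix (Fin 1) (Fin 1) E) 0 0)) = Valued.v (jE ϖ) ^ (2 * b))
    (hjl0 : Valued.v ((lam - jE ((u : Matrix (Fin 1) (Fin 1) E) 0 0)) - ρ (lam - jE ((u : Matrix (Fin 1) (Fin 1) E) 0 0))) =
      Valued.v (cc * (α - ρ α) * Y)) (mc : ℕ) :
    ¬ LatticeNearTransvShell ϖ 0 mc ((((endoGL (γ₂, u) : GL (Fin 3) E) : Matrix (Fin 3) (Fin 3) E) - 1)) L := fun h =>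
  h.2.1 (latticeInLevel_one_endoGL_sub_one_of_terminal hq hρρ hvρ hα hα1 hϖ jE hjv hjfix hEval φ hφs hφi hφγ hb hpr hB hg₀ hg₀1 hprg hBΛ hc hc0 hx₀ hΛx hw₀Y
    hYO hYp hb1 hYb hcb u hm1 hum hμ hjl0)

end Summit.HodgeConjecture.HodgeConjecture.Cruxes.H413.F0P3cDyRamTerminalCellOffShellCardTwo

end
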